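import Literature.AlgebraicGeometry.Motives.CotangentSheafProductFormula
import Literature.AlgebraicGeometry.HodgeTheory.CotangentSheafProductFormulaTransport
import Literature.AlgebraicGeometry.Motives.AbelianVarietyCotangentSheafAtOrigin
import Literature.AlgebraicGeometry.Motives.AbelianVarietyCotangentSheafFree
import HarnessLib

/-!
# Road №4 (`VHCAbelianSchemesRoad`) — (c1Ω) `stub_cotangentSheafFree` IS A THEOREM: the cotangent sheaf of an abelian variety is free,
# `Ω¹_{A/k} ≅ 𝒪_A^{dim A}` for every field `k` (crux stmt-HodgeConjecture-26512; research route conditional on HC_CM; not a corollary;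
# Q11.4-sentence-2 already refuted in dim ≥ 3)

Seat core-w8 gen 2, captain of route BLR-absolute (director-hodge g16 R16.40 ∕ R16.52), assembling the gen-2 width wave's landed bricks:

* (F1) ring-level product formula `Ω[P⁄k] ≅ (P ⊗_R Ω[R⁄k]) × (P ⊗_S Ω[S⁄k])` — core-w2 g2, `Algebra/Derivations/KaehlerDifferentialTensorProduct` (p661983);
* (P0) `Ω¹` is affine-localizing — core-w4 g2, `Motives/CotangentSheafAffineLocalizing` (p661805);
* (F2-pre) `dg : g^*Ω¹ ⟶ Ω¹`, chain rule, charts — core-w7 g2, `HodgeTheory/CotangentSheafPullbackHom(Charts)` (p662188, p662646, p663073);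
* (F2a) isomorphisms detected on an affine cover — core-qc g2, `Modules/IsoOfAffineCover` (p662521); (H1) sections of `⊞` — core-w2 g2 (p663268);
* (F2b) chart bijectivity — core-w7 g2, `Motives/CotangentSheafProductChart` (p664267); (F2c) product-chart cover ∕ pushout — core-w4 g2,
  `Motives/ProductAffineChartCover` (p664028); (F2e) **the sheaf product formula `(d fst, d snd) : fst^*Ω¹_Y ⊞ snd^*Ω¹_Z ≅ Ω¹_{Y ⊗ Z}`**
  (Görtz–Wedhorn II Cor. 17.32) — `Motives/CotangentSheafProductFormula`;
* (F3+F4) Bosch–Lütkebohmert–Raynaud §4.2 Prop. 2 — core-w8 g2: shear fan, `m^*Ω¹ ≅ fst^*Ω¹`, `Ω¹_G ≅ π^* e^* Ω¹_G`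
  (`GroupSchemes/CotangentSheafTranslationTrivial`, p662209; `HodgeTheory/CotangentSheafProductFormulaTransport`, p663581);
* (F5) `π^* e^* Ω¹_A ≅ 𝒪_A^{dim A}` (`𝔪_e/𝔪_e²` has dimension `dim A`) — core-w4 g2, `Motives/AbelianVarietyCotangentSheafAtOrigin` (p663014).

Main statement: `mumford1970_cotangentSheaf_abelianVariety_free_holds : Mumford1970_cotangentSheaf_abelianVariety_free` — the registered stub
(c1Ω) of skeleton v3.15 (`Cruxes/DiagLocalOfMarkmanPinnedForall/Lines/birth.lean` l.285) VERBATIM, i.e. the Literature named fact of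
`Motives/AbelianVarietyCotangentSheafFree` (p648227) is now a theorem: for every field `k` and every abelian variety `A` over `k`,
`Nonempty (cotangentSheaf A.X ≅ SheafOfModules.free (Fin A.dim))`. `--supports stmt-HodgeConjecture-26512 --as helper`; LEAD binds
`stub_cotangentSheafFree := mumford1970_cotangentSheaf_abelianVariety_free_holds`. ZERO named facts, no `sorry`, no def. Nothing here says (c1Fin),
(c1), 26512, №4, HC_AV, HC_CM or HC holds; HC_CM HELD, by name only.

References: [cite: MumfordAV1970, §4 (iii) (p. 42)] [cite: BoschLutkebohmertRaynaud1990, §4.2 Prop. 2] [cite: GortzWedhorn2023, Cor. 17.32, Prop. 27.15]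
[cite: LangeBirkenhake1992, §1.1 Lemma 1.1.22].
-/

noncomputable section

namespace Summit.HodgeConjecture.HodgeConjecture.Ring2.SemiregularRepresentatives

set_option linter.dupNamespace false -- the cell's namespace repeats the summit name, as in every `Ring2*` file

open CategoryTheory CategoryTheory.Limits MonoidalCategory CartesianMonoidalCategory AlgebraicGeometry
open Literature.AlgebraicGeometry.Motives Literature.AlgebraicGeometry.HodgeTheory Literature.AlgebraicGeometry.GroupSchemes

/-- **Mumford, AV §4 (iii) ∕ Bosch–Lütkebohmert–Raynaud §4.2 Prop. 2 ∕ Görtz–Wedhorn II Prop. 27.15: the cotangent sheaf of an abelian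
variety over a field is free of rank `dim A`, `Ω¹_{A/k} ≅ 𝒪_A^{dim A}`** — the registered stub (c1Ω) `stub_cotangentSheafFree` VERBATIM.
Proof: the sheaf product formula at `(fst, snd)` of `A ⊗ A` (F2e) ⟹ at the shear fan `(m, snd)` ⟹ `m^*Ω¹ ≅ fst^*Ω¹` ⟹ (restriction along
`x ↦ (e, x)`) `Ω¹_A ≅ π^* e^* Ω¹_A` (F3+F4) ⟹ `≅ 𝒪_A^{dim A}` since `e^*Ω¹_A` is the `k`-vector space `𝔪_e/𝔪_e²` of dimension `dim A` (F5).
[cite: MumfordAV1970, §4 (iii) (p. 42)] [cite: BoschLutkebohmertRaynaud1990, §4.2 Prop. 2] [cite: GortzWedhorn2023, Cor. 17.32, Prop. 27.15] -/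
theorem mumford1970_cotangentSheaf_abelianVariety_free_holds : Mumford1970_cotangentSheaf_abelianVariety_free := by
  intro k _ A
  haveI : IsIso (biprod.desc (cotangentSheaf.pullbackHom (fst A.X A.X)) (cotangentSheaf.pullbackHom (snd A.X A.X))) :=
    isIso_biprod_desc_pullbackHom_fst_snd A.X A.X
  obtain ⟨e⟩ := nonempty_cotangentSheaf_iso_pullback_unit_of_productFormula A.X
  obtain ⟨f⟩ := AbelianVariety.nonempty_pullback_hom_pullback_unitPt_cotangentSheaf_iso_free A
  exact ⟨e ≪≫ f⟩

end Summit.HodgeConjecture.HodgeConjecture.Ring2.SemiregularRepresentatives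

end
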